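import Summits.ABC.IUTFork.Joshi.ATS1SpacesStructure
import HarnessLib

/-!
# Joshi's ATS I (arXiv:2106.11452v4) Rmk. 5.8.3 — the three clauses DERIVED over the typed objects (proof-only companion)

Block E of the abc-iut cell (rung LADDER-ABC:A2.E; seat abc-iut-E-t21 gen 2, slot T-48 of the [J-I] fan-out; registry row
J1:Rmk5.8.3 of plan/E/JOSHI-DAG.tsv, «recorded, not typed» in `ATS1SpacesStructure` (p431517) — closed here under E-plan-2's
REMAINDER-LIST rule 09:19:12Z «companion only for what is genuinely missing»). SOURCE: K. Joshi, *Construction of Arithmetic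
Teichmüller Spaces I*, arXiv:2106.11452**v4** (UNREFEREED «Preliminary version»; bib `Joshi2021ATS1`; the series is rejected by the
IUT author, `Mochizuki2024JoshiReport`). Locator «p.N l.a–b» = PDF page N, lines of the cell's render
`plan/repair/lit/renders/Joshi-ATS1-2106.11452v4-PDFpaged-book-anonnd/pNNNN.txt`. TAKES NO SIDE on [IUTchIII] Cor. 3.12, on Joshi's
claims, or on Mochizuki's report; typed ≠ proved; typed AS A CANDIDATE ≠ endorsed. PROOF-ONLY: no `def`, no claim-`Prop`, no
instance, no notation; E-t1's carriers (`ATSObj`, `ATSObjF`, `UntiltPoints`, `act`, `orbit`) and the T-48 subspaces (`ATSObj.subcat`,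
`Jhyp`, E-t13's `ATSObj.strictBelyiSub`) are imported BY NAME, never restated.

PRINT (J1:Rmk5.8.3, p.29 l.32–35): «Thus for a geometrically connected, smooth, hyperbolic curve, `𝔍_hyp(X/E)` has properties similar
to classical Teichmüller Spaces: namely local scalings (Theorem 5.4.1, Corollary 5.4.2), the topological types of all objects and the
tempered fundamental group (and hence étale fundamental group) is fixed by Proposition 5.8.1.»

WHAT IS PROVED (three clauses, each as far as the typed carriers speak):
* «local scalings (Theorem 5.4.1, Corollary 5.4.2)» — E-t1's action `ATSObjF.act` of `Aut_{𝒪_E}(𝒢(𝒪_F))` on `𝔍(X,E)_F` («the point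
  moves, the curve and the label stay», `ArithTeichmullerAction`) RESTRICTS to `𝔍_hyp(X,E)` and to every subspace `𝔍_Σ` cut out by a
  condition on the curve `Y/E′` alone (`toObj_act_mem_subcat_iff`, `toObj_act_mem_Jhyp_iff`, `toObj_act_mem_strictBelyiSub_iff`,
  `orbit_toObj_mem_Jhyp`): `𝔍_hyp` HAS the local scalings.
* «the topological types of all objects … is fixed by Proposition 5.8.1» — unfolded from the claim `ATSObj.SameTopologicalType`
  (Prop. 5.8.1 (1), HYPOTHESIS BY NAME, never asserted): pairwise equality of `topType` on `𝔍_hyp` (`topType_eq_of_sameTopologicalType`).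
* «the tempered fundamental group … is fixed» — in E-t1's typing every object carries its label `α : Π^temp_Y ≃ₜ* Π^temp_X`, so this
  clause holds on all of `𝔍(X,E)` BY CONSTRUCTION — already landed as E-t19's `ATSObj.prop551_1` (p431648) / `ATS1.thm743_2`, cited
  BY NAME; here only its `𝔍(X,E)_F` form under local scalings (`ATSObjF.toObj_act_α`, `ATSObjF.nonempty_piTemp_equiv_act`). The parenthetical «hence étale fundamental group» has no carrier on the [SemiAnbd] §6 curve
  interface (no profinite completion field) and is not typed.
Standard axioms only; sorry-free.
-/

noncomputable section

namespace Summit.ABC.IUTFork.Joshi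

open Literature.AnabelianGeometry.SemiGraphs (TemperedCurve)

variable {p : ℕ} [Fact p.Prime]

/-! ## 1. «the tempered fundamental group … is fixed»; «the topological types of all objects … fixed by Proposition 5.8.1» -/

namespace ATSObj

variable {X : TemperedCurve p}

/- Rmk. 5.8.3, clause «the tempered fundamental group … is fixed» (p.29 l.34–35): in E-t1's typing every object `(Y/E′, E′ ↪ K, α)`
of `𝔍(X,E)` carries its label `α : Π^temp_Y ≃ₜ* Π^temp_X`, so the clause holds on all of `𝔍(X,E)` BY CONSTRUCTION — this is ALREADY
LANDED as E-t19's `ATSObj.prop551_1` (ATS1SpacesBasic, p431648) and, pairwise, as `ATS1.thm743_2` (ATS1UntiltsOfFundamentalGroups);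
cited BY NAME, not restated (gate dedup). The `𝔍(X,E)_F` form «unchanged under local scalings» is `ATSObjF.toObj_act_α` below. -/

/-- Rmk. 5.8.3, clause «the topological types of all objects … is fixed by Proposition 5.8.1» (p.29 l.34–35), unfolded from the claim
`SameTopologicalType` (Prop. 5.8.1 (1) = [Mochizuki 2004, Lem. 1.3.9], HYPOTHESIS BY NAME): every object of `𝔍_hyp(X,E)` has the
topological type `(genus, punctures)` of `X/E`. [folklore] -/
theorem topType_eq_of_mem_Jhyp {IsHyp : TemperedCurve p → Prop} {topType : TemperedCurve p → ℕ × ℕ}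
    (h : SameTopologicalType IsHyp topType X) (hX : IsHyp X) {A : ATSObj X} (hA : A ∈ Jhyp IsHyp X) :
    topType A.Y = topType X := h hX A hA

/-- … so the topological type is CONSTANT on `𝔍_hyp(X,E)`: any two objects have the same `(genus, punctures)`. [folklore] -/
theorem topType_eq_of_sameTopologicalType {IsHyp : TemperedCurve p → Prop} {topType : TemperedCurve p → ℕ × ℕ}
    (h : SameTopologicalType IsHyp topType X) (hX : IsHyp X) {A B : ATSObj X} (hA : A ∈ Jhyp IsHyp X) (hB : B ∈ Jhyp IsHyp X) :
    topType A.Y = topType B.Y := (topType_eq_of_mem_Jhyp h hX hA).trans (topType_eq_of_mem_Jhyp h hX hB).symm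

end ATSObj

/-! ## 2. «local scalings (Theorem 5.4.1, Corollary 5.4.2)»: E-t1's action restricts to `𝔍_hyp(X,E)` -/

namespace ATSObjF

variable {X : TemperedCurve p} {𝒪E : Type} [CommRing 𝒪E] {D : UntiltPoints p 𝒪E}

/-- A local scaling does not change the curve `Y/E′` of an object of `𝔍(X,E)_F` (only the untilt `K_y ↦ K_{σ(y)}` moves). [folklore] -/
theorem toObj_act_Y (σ : D.Aut) (A : ATSObjF X D) : (act σ A).toObj.Y = A.toObj.Y := rfl

/-- A local scaling does not change the label: `Π^temp_{Y/E′} ≅ Π^temp_{X/E}` is the SAME isomorphism before and after (Rmk. 5.8.3's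
«tempered fundamental group … is fixed», `𝔍(X,E)_F` form). [folklore] -/
theorem toObj_act_α (σ : D.Aut) (A : ATSObjF X D) : (act σ A).toObj.α = A.toObj.α := rfl

/-- … in particular the scaled object again has `Π^temp_{Y/E′} ≅ Π^temp_{X/E}`. [folklore] -/
theorem nonempty_piTemp_equiv_act (σ : D.Aut) (A : ATSObjF X D) : Nonempty ((act σ A).toObj.Y.PiTemp ≃ₜ* X.PiTemp) :=
  ⟨(act σ A).toObj.α⟩

/-- Rmk. 5.8.3, clause «local scalings (Theorem 5.4.1, Corollary 5.4.2)» (p.29 l.33–34): every subspace `𝔍_Σ(X,E)` ((5.7.1)) cut out by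
a condition `Σ` on the curve `Y/E′` ALONE is stable under E-t1's action of `Aut_{𝒪_E}(𝒢(𝒪_F))` on `𝔍(X,E)_F`: `σ·A ∈ 𝔍_Σ ↔ A ∈ 𝔍_Σ`.
PROVED (the action fixes `Y/E′`). [folklore] -/
theorem toObj_act_mem_subcat_iff (Sig : TemperedCurve p → Prop) (σ : D.Aut) (A : ATSObjF X D) :
    (act σ A).toObj ∈ ATSObj.subcat (fun B : ATSObj X => Sig B.Y) ↔ A.toObj ∈ ATSObj.subcat (fun B : ATSObj X => Sig B.Y) :=
  Iff.rfl

/-- **Rmk. 5.8.3 — `𝔍_hyp(X,E)` has the local scalings**: the action of `Aut_{𝒪_E}(𝒢(𝒪_F))` (Thm. 5.4.1 / Cor. 5.4.2 = E-t1's `act`)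
preserves `𝔍_hyp(X,E)`. PROVED. [folklore] -/
theorem toObj_act_mem_Jhyp_iff (IsHyp : TemperedCurve p → Prop) (σ : D.Aut) (A : ATSObjF X D) :
    (act σ A).toObj ∈ ATSObj.Jhyp IsHyp X ↔ A.toObj ∈ ATSObj.Jhyp IsHyp X := Iff.rfl

/-- … and preserves `𝔍_SB(X,E)` (E-t13's `strictBelyiSub`). PROVED. [folklore] -/
theorem toObj_act_mem_strictBelyiSub_iff (IsSB : TemperedCurve p → Prop) (σ : D.Aut) (A : ATSObjF X D) :
    (act σ A).toObj ∈ ATSObj.strictBelyiSub IsSB X ↔ A.toObj ∈ ATSObj.strictBelyiSub IsSB X := Iff.rfl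

/-- The whole orbit of an object of `𝔍_hyp(X,E)_F` under the local scalings lies in `𝔍_hyp(X,E)`. PROVED. [folklore] -/
theorem orbit_toObj_mem_Jhyp (IsHyp : TemperedCurve p → Prop) {A : ATSObjF X D} (hA : A.toObj ∈ ATSObj.Jhyp IsHyp X) :
    ∀ B ∈ orbit A, B.toObj ∈ ATSObj.Jhyp IsHyp X := by
  rintro B ⟨σ, rfl⟩
  exact (toObj_act_mem_Jhyp_iff IsHyp σ A).2 hA

/-- Rmk. 5.8.3 assembled on `𝔍_hyp(X,E)_F`: for an object `A` of `𝔍_hyp` and a local scaling `σ`, the scaled object is again in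
`𝔍_hyp`, has the same curve (hence, under the claim `SameTopologicalType`, the topological type of `X/E`), and the same tempered
fundamental group `≅ Π^temp_{X/E}`. PROVED (second conjunct modulo Prop. 5.8.1 (1) BY NAME). [folklore] -/
theorem rmk583 (IsHyp : TemperedCurve p → Prop) (topType : TemperedCurve p → ℕ × ℕ)
    (h581 : ATSObj.SameTopologicalType IsHyp topType X) (hX : IsHyp X) (σ : D.Aut) {A : ATSObjF X D}
    (hA : A.toObj ∈ ATSObj.Jhyp IsHyp X) :
    (act σ A).toObj ∈ ATSObj.Jhyp IsHyp X ∧ topType (act σ A).toObj.Y = topType X ∧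
      Nonempty ((act σ A).toObj.Y.PiTemp ≃ₜ* X.PiTemp) :=
  ⟨(toObj_act_mem_Jhyp_iff IsHyp σ A).2 hA,
    ATSObj.topType_eq_of_mem_Jhyp h581 hX ((toObj_act_mem_Jhyp_iff IsHyp σ A).2 hA), nonempty_piTemp_equiv_act σ A⟩

end ATSObjF

end Summit.ABC.IUTFork.Joshi

end
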